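import Summits.NavierStokesRegularity.NavierStokesRegularity.Theses.ExtremalTypeIConstant
import HarnessLib.Audit
import Mathlib.Analysis.SpecialFunctions.Exponential
import Mathlib.Analysis.InnerProductSpace.PiL2
import Summits.NavierStokesRegularity.NavierStokesRegularity.Theorems.ExtremalTypeIConstantExtremalSpiralSymmetryStubClosedSubgroupCharacter
import Summits.NavierStokesRegularity.NavierStokesRegularity.Theorems.ExtremalTypeIConstantExtremalSpiralSymmetryStubGeneratorOfFamily
import Summits.NavierStokesRegularity.NavierStokesRegularity.Theorems.ExtremalTypeIConstantExtremalSpiralSymmetryStubStabiliserClosedSubgroup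
import Summits.NavierStokesRegularity.NavierStokesRegularity.Theorems.ExtremalTypeIConstantExtremalSpiralSymmetryStubSymmetryFamily
import Summits.NavierStokesRegularity.NavierStokesRegularity.Theorems.ExtremalTypeIConstantExtremalSpiralSymmetryPeriodToRDSS
import Summits.NavierStokesRegularity.NavierStokesRegularity.Theorems.ExtremalTypeIConstantExtremalSpiralSymmetryRdssLiouvilleOfInClass

/-!
# Birth skeleton (BC3) of the crux `ExtremalTypeIConstant.ExtremalSpiralSymmetry`

(crux item `stmt-NavierStokesRegularity-8215`, rank 2, route `route-NavierStokesRegularity-ExtremalTypeIConstant`;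
tree path `Cruxes/ExtremalSpiralSymmetry/Lines/birth.lean`; registrar
`planner-skel-stmt-NavierStokesRegularity-8215-0`, 2026-08-17. The route predates the Lean birth certificate;
this file supplies BC3 retroactively. No `Disproof.lean` exists for this crux yet.)

THE CRUX. `ExtremalSpiralSymmetry`: every EXTREMAL pair `(C, u)` — `u ∈ A_C` (smooth, divergence free,
KNSS–Oseen mild between all `s < t < 0`, `‖u(t,x)‖ ≤ C/√(−t)`), `0 < C = ‖u(−1,0)‖` (the Type-I bound is
ATTAINED at the interior hot spot `(−1,0)`), and `C ≤ C'` whenever `A_{C'}` has a nontrivial element — is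
invariant under a one-parameter group of spiral scalings: `∃ a, ∃ A skew, ∇u·(a + x + Ax) + u + 2t ∂ₜu − Au ≡ 0`
on `t < 0`.

THE CUT — the route's own two-layer plan (`ExtremalScalingRecurrent` + `NoDiscreteExtremal`, route header
"TWO-LAYER PLAN") followed by the closed-subgroup step and glued by the pinning argument, both named in the
crux text ("a stabiliser meeting every scaling factor near 1 contains a one-parameter spiral scaling
(closed-subgroup argument)"; "extremality pins the blow-up time of the symmetry to T′ = 0"). Write
`S_c u (t,x) = c • u (c²t, c•x)` (`= nsRescale c u`), `g_{b,R} u (t,x) = R (u t (R⁻¹(x − b)))` for a linear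
isometry `R` and `b ∈ ℝ³`, and `θ_δ u (t,x) = u (t − δ, x)`, `δ ≥ 0` (forward time shift). All three preserve
every class `A_C` (in tree: `isTypeIAncientMild_nsRescale`, `isTypeIAncientMild_translate`,
`isTypeIAncientMild_conj_linearIsometryEquiv`; the time shift by the monotonicity `C/√(δ−t) ≤ C/√(−t)`), so the
honest symmetry SEMIGROUP of the minimiser set is generated by all of them — "isolated modulo translations and
rotations" (the card's Conjecture M) must be read modulo `θ_δ` as well, else the time-shifted copies
`θ_δ u → u` of any extremal refute isolatedness outright.

* `stub_scalingRecurrence` [L–XL, OPEN — Conjecture M, recurrence half = the plan's `ExtremalScalingRecurrent`]: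
  an extremal `(C,u)` has ONE nontrivial scaling period modulo the symmetry semigroup: `∃ c > 0, c ≠ 1, ∃ δ ≥ 0,
  b, R` with `S_c u = g_{b,R} θ_δ u` on `t < 0` (u is λ-DSS / RDSS up to a time shift). Why it might fail: an
  extremal whose scaling curve `c ↦ S_c u` never returns to its orbit (a continuum of symmetry-free extremals).
* `stub_continuousOfDiscrete` [XL, OPEN — Conjecture M, rigidity half = the plan's `NoDiscreteExtremal`]: an
  extremal with one exact scaling period `S_c u = g_{b,R} u`, `c ≠ 1`, has them for ALL factors near `1`:
  `∃ δ₀ > 0, ∀ c', |c' − 1| < δ₀ → ∃ δ ≥ 0, b', R', S_{c'} u = g_{b',R'} θ_δ u`. Why it might fail: a DSS-but-not-SS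
  extremal (the truncated-dyadic Type-I blow-up IS exactly DSS; Bradshaw–Tsai 2017 Open Problem 5.1). It must
  use the Oseen identity and the minimality clause: in the H3-free kinematic class discrete self-similarity
  forces NO continuous symmetry (landed negative lemmas `ForcedSymmetry.Negative.dss_does_not_force_symmetry`,
  `exists_dss_symmetryFree`, `forcedSymmetry_false_without_H3` of the sibling crux `ForcedSymmetry`) — honoured:
  both open stubs carry the full extremal hypothesis (class WITH the Oseen identity + attainment + minimality),
  and neither is an instance those lemmas refute (their witness `ud` is not Oseen-mild).
* `stub_spiralGenerator` [L, a THEOREM to formalise — Cartan's closed-subgroup theorem + chain rule; not in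
  Mathlib]: if `u` is differentiable on the open slab and for every `c` near `1` some rigid motion `g_{b,R}`
  has `S_c u = g_{b,R} u` on `t < 0` (NO regularity of `c ↦ (b,R)` assumed), then `u` has an infinitesimal
  spiral-scaling symmetry `∇u·(a + x + Ax) + u + 2t∂ₜu − Au ≡ 0`, `A` skew. Proof on paper: the stabiliser of
  `u` in the 7-dimensional similarity group `Γ = ℝ₊ × (O(3) ⋉ ℝ³)` (acting by `u ↦ c R u(c²t, cR⁻¹x + d)`) is
  CLOSED (`u` continuous), its dilation character `χ` is onto a neighbourhood of `1`, hence onto `ℝ₊`; by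
  Cartan it is a Lie subgroup with countably many components, so `χ` is already onto on the identity
  component, `dχ ≠ 0` on its Lie algebra, and `exp(sξ)` with `dχ(ξ) = 1` is a one-parameter subgroup of
  symmetries; differentiating `s ↦ (exp(sξ)·u)(t,x)` at `s = 0` gives the generator with `a = ḋ(0)`,
  `A = −Ṙ(0)`.

`ExtremalSpiralSymmetry_of : ExtremalSpiralSymmetry` (the ONLY theorem here concluding the crux; A12 layer
invariant: conclusion = the crux BY NAME, no `Prop` hypotheses, `sorry` only inside the three declared stubs,
which it uses by name) is the REAL composition: recurrence (stub 1) ↦ PINNING `δ = 0` (`timeShift_pinned`,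
proved here: compare the two sides of `S_c u = g θ_δ u` at the transported hot spot `(−1/c², 0)` — the left side
has norm `cC`, the right side at most `C/√(1/c² + δ)` by the Type-I bound, so `c²δ ≤ 0`) ↦ rigidity (stub 2)
↦ pinning again for every factor in `|c − 1| < min δ₀ ½` ↦ the local rigid stabiliser ↦ generator (stub 3, fed
with differentiability extracted from the class). Its CLOSED twin `ExtremalSpiralSymmetry_of_hyps` (the three
stub STATEMENTS as hypotheses, same proof, no `sorry` anywhere) is the registrar's evidence file
`bc/ExtremalSpiralSymmetry_birth_closed.lean`.

RESHAPE (lead `prover-line-stmt-NavierStokesRegularity-8215-c1-0`, 2026-08-17). `stub_spiralGenerator` is no longer a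
stub: it is PROVED here (`spiralGenerator_of_stubs`) from three new registered stubs with self-contained signatures —
`stub_closedSubgroupCharacter` (abstract: a closed subgroup of the units of a finite-dimensional real Banach algebra
whose character `ℓ` covers a neighbourhood of `1` has a one-parameter subgroup `exp(tX)` with `ℓ X = 1`; von
Neumann–Cartan, in tree as `Literature.Analysis.Calculus.exists_exp_chart_of_isClosed`, plus a countability
argument), `stub_generatorOfFamily` (chain rule along a differentiable family of rigid scaling symmetries) and
the stabiliser embedding `Stab(u) ↪ 𝕍 = End(ℝ³×ℝ) × ℝ × ℝ` in two pieces: `stub_stabiliserClosedSubgroup` (it is a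
closed subgroup when `u` is continuous) and `stub_symmetryFamily` (reading the differentiable family off `exp(sX)`,
taking the abstract lemma and the closed-group facts as hypotheses so that all pieces are independent). Stubs 1–2 and
the pinning glue are unchanged (6 stubs ≤ stubs_max 7; v4: 3a, 3b, 3c-i, 3c-ii ALL LANDED — p147108, p147157, p149187,
p149196 — so `spiralGenerator_of_stubs` is fully proved and the only `sorry`s left are stubs 1–2 = Conjecture M).

RESHAPE v5 (lead `prover-line-stmt-NavierStokesRegularity-8215-c2-0`, 2026-08-17). Stub 2 is RE-SOURCED: a scaling
period modulo a rigid motion with factor `c ≠ 1` is, about its CENTRE `x₀` (`c⁻¹x₀ − Rx₀ = b`; `c⁻¹ − R` is onto since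
`R` is an isometry and `c⁻¹ ≠ 1`), rotated discrete self-similarity with blow-up time `0`, and inverting the period
makes the factor `> 1` — the new PROVABLE stub `stub_periodToRDSS` (landed by the lead's support file
`Theorems/ExtremalTypeIConstantExtremalSpiralSymmetryPeriodToRDSS.lean`); so the rigidity half of Conjecture M follows
VACUOUSLY (`continuousOfDiscrete_of_stubs`, proved here: the extremal has `‖u(−1,0)‖ = C > 0`) from the new OPEN stub
`stub_rdssLiouville` = the bounded-profile rotated-DSS Type-I Liouville statement in the KNSS gauge ("every `u ∈ A_C`
that is `(c,R)`-RDSS about some `(0,x₀)` on `t < 0` with `c > 1` vanishes") — a NAMED open problem (Tsai 2018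
Conj. 8.8/8.9 = Bradshaw–Tsai 2017 OP 5.1 for merely BOUNDED profiles). Its space-decaying part is exactly the tree's
conjecture leaf `TypeIDSSLiouvilleConjecture` (`rdss_trivial_of_spaceDecay_of_conjecture` in the support file) and its
one proved rung inside `A_C` is Chae–Wolf 2017 Thm 1.3 (`rdss_trivial_nearOne_of_spaceDecay`, via the tree's discharge
`chaeWolf2017_removing_dss_holds`: `R = 1`, `1 < c < λ_*(C₀)`, space–time decay). Registered stubs v5:
`stub_scalingRecurrence` (OPEN, Conjecture M recurrence half = "every extremal is RDSS"), `stub_periodToRDSS` (landed),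
`stub_rdssLiouville` (OPEN, named wall); the composition below is unchanged otherwise (generator machinery all landed).
v6 (same lead): `stub_periodToRDSS` wired to the landed decl (p152650); `stub_rdssLiouville` ⟸ crux stmt-8561
`DulacContraction.RDSSLiouvilleInClass` LANDED (p152941, displayed below as `rdssLiouville_of_rdssLiouvilleInClass`); necessity
crux ⇒ `stub_scalingRecurrence` landed (worker audit file `…ScalingRecurrenceOfCrux.lean`); and the structural consequence
8561 ∧ stub 1 ∧ MinimiserExists(8217, proved) ⇒ route TARGET 4050 landed (`…TargetOfRecurrence.lean`). So modulo the shared wall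
stmt-8561 this crux ⇔ `stub_scalingRecurrence` (its only new content), and crux 3 (8216) is not needed by the route.
v7 (same lead, docs only; stubs unchanged): further landed structure — `stub_rdssLiouville` ⇔ stmt-8561 BOTH ways
(`…InClassOfRdssLiouville.lean` p153721); 8216 ⟸ 8561 (`…Crux3OfRdssWall.lean` p154081); crux ⟸ local scaling stabiliser of every
extremal = Conjecture M as isolatedness mod rigid motions + time shifts (`…OfLocalStabiliser.lean` p155658, packaging the landed
generator half); unconditional facts about extremals towards stub 1: far-past saturation (`…FarPastSaturation.lean` p153944),
blow-downs along saturating far-past times are extremal (`…BlowDown.lean` p155000), blow-down calculus (`…BlowDownCalculus.lean`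
p155489) and Birkhoff recurrence — SOME extremal is a blow-down of itself (`…SelfRecurrentExtremal.lean`). Status for planners:
`Cruxes/ExtremalSpiralSymmetry/LeadC2Status.md`.
v8 (lead `prover-line-stmt-NavierStokesRegularity-8215-c3-0`, 2026-08-17; stubs unchanged): the lead holds `stub_scalingRecurrence`;
`stub_rdssLiouville` is the existing item stmt-8561 (certified ⇔, p152941/p153721) and is not delegated; no `Disproof.lean` exists.

BC3 PROBES (registrar folder `bc/ExtremalSpiralSymmetry_probes.lean`, `lean check`): for each stub `S`,
`S → ExtremalSpiralSymmetry` and `S → NavierStokesRegularity` by `first | exact? | simpa | aesop` FAIL (outputs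
quoted in the registrar's NOTES.md and in `Lines/birth.md`): no stub is cheaply the crux or the summit.
-/

noncomputable section

open Set MeasureTheory Filter Topology
open Literature.Analysis.FluidPDE

namespace Summit.NavierStokesRegularity.NavierStokesRegularity.Cruxes.ExtremalSpiralSymmetry.Birth

set_option linter.unusedVariables false
set_option linter.dupNamespace false

/-- Local notation for physical space `ℝ³`. -/
local notation "E3" => EuclideanSpace ℝ (Fin 3)

/-- The ambient algebra `End(ℝ³ × ℝ) × ℝ × ℝ` of the stabiliser embedding (stubs 3c-i/3c-ii). -/
local notation "𝕍" => ((EuclideanSpace ℝ (Fin 3) × ℝ) →L[ℝ] (EuclideanSpace ℝ (Fin 3) × ℝ)) × ℝ × ℝ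

/-- `Aff(c, R, d)` : the linear map `(y, r) ↦ (c • R y + r • d, r)` of `ℝ³ × ℝ` (the affine map `y ↦ cRy + d` in
homogeneous coordinates). -/
local notation "Aff(" c ", " R ", " d ")" =>
  (ContinuousLinearMap.prod
    (ContinuousLinearMap.comp ((c : ℝ) • (R : EuclideanSpace ℝ (Fin 3) →L[ℝ] EuclideanSpace ℝ (Fin 3)))
        (ContinuousLinearMap.fst ℝ (EuclideanSpace ℝ (Fin 3)) ℝ) +
      ContinuousLinearMap.smulRight (ContinuousLinearMap.snd ℝ (EuclideanSpace ℝ (Fin 3)) ℝ)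
        (d : EuclideanSpace ℝ (Fin 3)))
    (ContinuousLinearMap.snd ℝ (EuclideanSpace ℝ (Fin 3)) ℝ))

-- `quotPrecheck` cannot look under the binders of this notation (it is a plain macro; nothing is hidden)
set_option quotPrecheck false in
/-- `Stab(u)` : the image in `𝕍` of the group of rigid parabolic scaling symmetries `(c, R, b)` of `u` on `t < 0`
(`c u(c²t, cx) = R u(t, R⁻¹(x - b))`) under `(c, R, b) ↦ (Aff(c, R, c b), c, c⁻¹)`. -/
local notation "Stab(" u ")" =>
  (setOf fun M : 𝕍 =>
    ∃ (c : ℝ) (R : EuclideanSpace ℝ (Fin 3) ≃ₗᵢ[ℝ] EuclideanSpace ℝ (Fin 3)) (b : EuclideanSpace ℝ (Fin 3)),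
      0 < c ∧ M = (Aff(c, (R : EuclideanSpace ℝ (Fin 3) →L[ℝ] EuclideanSpace ℝ (Fin 3)), c • b), c, c⁻¹) ∧
      ∀ t < (0:ℝ), ∀ x, c • u (c ^ 2 * t) (c • x) = R (u t (LinearIsometryEquiv.symm R (x - b))))

/-- **stub 1 — `stub_scalingRecurrence` (L–XL, OPEN; Conjecture M, recurrence half = `ExtremalScalingRecurrent`).**
An extremal pair `(C, u)` (hypotheses copied verbatim from the crux) has one nontrivial scaling period modulo
the class-preserving semigroup (rigid motions and forward time shifts): `S_c u = g_{b,R} θ_δ u` on `t < 0` for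
some `c > 0`, `c ≠ 1`, `δ ≥ 0`, `b ∈ ℝ³`, `R` a linear isometry. -/
theorem stub_scalingRecurrence :
    ∀ (C : ℝ) (u : ℝ → E3 → E3), 0 < C →
      (ContDiffOn ℝ (⊤ : ℕ∞) (Function.uncurry u) (Set.Iio 0 ×ˢ Set.univ) ∧
          (∀ t < 0, Literature.Analysis.FluidPDE.VectorCalculus.IsDivFree (u t)) ∧
          (∀ s t : ℝ, s < t → t < 0 → ∀ x, u t x =
            Literature.Analysis.FluidPDE.heatFlow (u s) (t - s) x -
              ∫ τ in Set.Ioo s t, ∫ y,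
                Literature.Analysis.FluidPDE.oseenKernel (t - τ) (x - y) (u τ y) (u τ y)) ∧
          Literature.Analysis.FluidPDE.HasTypeITimeDecay C u) ∧
        ‖u (-1) 0‖ = C ∧
        (∀ (C' : ℝ) (u' : ℝ → E3 → E3),
          (ContDiffOn ℝ (⊤ : ℕ∞) (Function.uncurry u') (Set.Iio 0 ×ˢ Set.univ) ∧
            (∀ t < 0, Literature.Analysis.FluidPDE.VectorCalculus.IsDivFree (u' t)) ∧
            (∀ s t : ℝ, s < t → t < 0 → ∀ x, u' t x =
              Literature.Analysis.FluidPDE.heatFlow (u' s) (t - s) x -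
                ∫ τ in Set.Ioo s t, ∫ y,
                  Literature.Analysis.FluidPDE.oseenKernel (t - τ) (x - y) (u' τ y) (u' τ y)) ∧
            Literature.Analysis.FluidPDE.HasTypeITimeDecay C' u') →
          (∃ t < 0, ∃ x, u' t x ≠ 0) → C ≤ C') →
      ∃ c : ℝ, 0 < c ∧ c ≠ 1 ∧ ∃ (δ : ℝ) (b : E3) (R : E3 ≃ₗᵢ[ℝ] E3), 0 ≤ δ ∧
        ∀ t < 0, ∀ x, c • u (c ^ 2 * t) (c • x) = R (u (t - δ) (R.symm (x - b))) := by
  sorry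

/-- **stub 2a — `stub_periodToRDSS` (S, LANDED p152650, `Theorems/ExtremalTypeIConstantExtremalSpiralSymmetryPeriodToRDSS.lean`).** A scaling period modulo a rigid motion,
`c u(c²t, cx) = R u(t, R⁻¹(x − b))` on `t < 0` with `c > 0`, `c ≠ 1`, is rotated discrete self-similarity with
blow-up time `0` about a centre `x₀` and with factor `> 1`: `c' R'ᵀ u(c'²t, x₀ + c'R'y) = u(t, x₀ + y)` on `t < 0` for
some `c' > 1`, `R'`, `x₀` (centre: solve `c⁻¹x₀ − Rx₀ = b`, possible since `c⁻¹ − R` is injective; if `c < 1` invert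
the period, `(c, R) ↦ (c⁻¹, R⁻¹)`). Pure linear algebra; no hypothesis on `u`. -/
theorem stub_periodToRDSS :
    ∀ (u : ℝ → EuclideanSpace ℝ (Fin 3) → EuclideanSpace ℝ (Fin 3)) (c : ℝ)
      (b : EuclideanSpace ℝ (Fin 3)) (R : EuclideanSpace ℝ (Fin 3) ≃ₗᵢ[ℝ] EuclideanSpace ℝ (Fin 3)),
      0 < c → c ≠ 1 →
      (∀ t < (0 : ℝ), ∀ x, c • u (c ^ 2 * t) (c • x) = R (u t (R.symm (x - b)))) →
      ∃ (c' : ℝ) (R' : EuclideanSpace ℝ (Fin 3) ≃ₗᵢ[ℝ] EuclideanSpace ℝ (Fin 3)) (x₀ : EuclideanSpace ℝ (Fin 3)),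
        1 < c' ∧ ∀ t < (0 : ℝ), ∀ y, c' • R'.symm (u (c' ^ 2 * t) (x₀ + c' • R' y)) = u t (x₀ + y) :=
  _root_.Summit.NavierStokesRegularity.NavierStokesRegularity.Theorems.ExtremalSpiralSymmetry.Registered.stub_periodToRDSS

/-- **stub 2b — `stub_rdssLiouville` (XL, OPEN — the bounded-profile rotated-DSS Type-I Liouville wall in the KNSS
gauge; contains Tsai 2018 Conj. 8.8/8.9 = Bradshaw–Tsai 2017 Open Problem 5.1 for merely BOUNDED profiles).** Every
element of `A_C` (hypotheses copied verbatim from the crux) which is `(c, R)`-rotated-discretely-self-similar about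
some `(0, x₀)` on `t < 0` with `c > 1` vanishes on `t < 0`. Known: the space-decaying case follows from the tree's
conjecture leaf `TypeIDSSLiouvilleConjecture` (support file, `rdss_trivial_of_spaceDecay_of_conjecture`), and is
PROVED for `R = 1`, `1 < c < λ_*(C₀)` (Chae–Wolf 2017 Thm 1.3, `rdss_trivial_nearOne_of_spaceDecay`); the gap beyond
the catalogued conjecture is spatial decay of a bounded RDSS profile of the class (cf. crux stmt-8561/8563). Why it
might fail: one bounded-profile backward RDSS solution (which would refute the route target with it). -/
theorem stub_rdssLiouville :
    ∀ (C : ℝ) (u : ℝ → EuclideanSpace ℝ (Fin 3) → EuclideanSpace ℝ (Fin 3)) (c : ℝ)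
      (R : EuclideanSpace ℝ (Fin 3) ≃ₗᵢ[ℝ] EuclideanSpace ℝ (Fin 3)) (x₀ : EuclideanSpace ℝ (Fin 3)),
      (ContDiffOn ℝ (⊤ : ℕ∞) (Function.uncurry u) (Set.Iio 0 ×ˢ Set.univ) ∧
          (∀ t < 0, Literature.Analysis.FluidPDE.VectorCalculus.IsDivFree (u t)) ∧
          (∀ s t : ℝ, s < t → t < 0 → ∀ x, u t x =
            Literature.Analysis.FluidPDE.heatFlow (u s) (t - s) x -
              ∫ τ in Set.Ioo s t, ∫ y,
                Literature.Analysis.FluidPDE.oseenKernel (t - τ) (x - y) (u τ y) (u τ y)) ∧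
          Literature.Analysis.FluidPDE.HasTypeITimeDecay C u) →
      1 < c →
      (∀ t < (0 : ℝ), ∀ y, c • R.symm (u (c ^ 2 * t) (x₀ + c • R y)) = u t (x₀ + y)) →
      ∀ t < (0 : ℝ), ∀ x, u t x = 0 := by
  sorry

/-- **Stub 2b IS crux stmt-8561** (LANDED p152941, `Theorems/…RdssLiouvilleOfInClass.lean`,
`stub_rdssLiouville_of_rdssLiouvilleInClass`): assuming `DulacContraction.RDSSLiouvilleInClass` (the RDSS Liouville wall
in Albritton–Barker's slab class `𝒦`, crux stmt-8561 with its own line), `stub_rdssLiouville` holds — translate the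
centre to `0`, take the `𝒦`-package of the class (`slabProfile_of_isTypeIAncientMild`, resting on the PROVED crux
`FarPastLedger` stmt-14060: one pressure, classical on `t<0`, suitable weak, weak gradient, `𝐈 < ∞`), the RDSS identity
a.e. on the slab, and the fact that a nontrivial RDSS field is backward-singular at its centre. Recorded here so that
the skeleton displays the dependency; the stub above stays a `sorry` (8561 is open). -/
theorem rdssLiouville_of_rdssLiouvilleInClass
    (h8561 : _root_.Summit.NavierStokesRegularity.NavierStokesRegularity.Theses.DulacContraction.RDSSLiouvilleInClass) :
    ∀ (C : ℝ) (u : ℝ → EuclideanSpace ℝ (Fin 3) → EuclideanSpace ℝ (Fin 3)) (c : ℝ)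
      (R : EuclideanSpace ℝ (Fin 3) ≃ₗᵢ[ℝ] EuclideanSpace ℝ (Fin 3)) (x₀ : EuclideanSpace ℝ (Fin 3)),
      (ContDiffOn ℝ (⊤ : ℕ∞) (Function.uncurry u) (Set.Iio 0 ×ˢ Set.univ) ∧
          (∀ t < 0, Literature.Analysis.FluidPDE.VectorCalculus.IsDivFree (u t)) ∧
          (∀ s t : ℝ, s < t → t < 0 → ∀ x, u t x =
            Literature.Analysis.FluidPDE.heatFlow (u s) (t - s) x -
              ∫ τ in Set.Ioo s t, ∫ y,
                Literature.Analysis.FluidPDE.oseenKernel (t - τ) (x - y) (u τ y) (u τ y)) ∧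
          Literature.Analysis.FluidPDE.HasTypeITimeDecay C u) →
      1 < c →
      (∀ t < (0 : ℝ), ∀ y, c • R.symm (u (c ^ 2 * t) (x₀ + c • R y)) = u t (x₀ + y)) →
      ∀ t < (0 : ℝ), ∀ x, u t x = 0 :=
  _root_.Summit.NavierStokesRegularity.NavierStokesRegularity.Theorems.ExtremalSpiralSymmetry.Registered.stub_rdssLiouville_of_rdssLiouvilleInClass
    h8561

/-- **The rigidity half of Conjecture M from stubs 2a–2b (formerly the registered stub `stub_continuousOfDiscrete`,
v1–v4), VACUOUSLY.** An extremal pair `(C, u)` with ONE exact scaling period `S_c u = g_{b,R} u`, `c ≠ 1`, has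
scaling symmetries modulo the class-preserving semigroup for every factor near `1` — because it cannot exist: the
period is RDSS about a centre with factor `> 1` (stub 2a), so `u ≡ 0` on `t < 0` (stub 2b), contradicting
`‖u(−1, 0)‖ = C > 0`. -/
theorem continuousOfDiscrete_of_stubs :
    ∀ (C : ℝ) (u : ℝ → E3 → E3), 0 < C →
      (ContDiffOn ℝ (⊤ : ℕ∞) (Function.uncurry u) (Set.Iio 0 ×ˢ Set.univ) ∧
          (∀ t < 0, Literature.Analysis.FluidPDE.VectorCalculus.IsDivFree (u t)) ∧
          (∀ s t : ℝ, s < t → t < 0 → ∀ x, u t x =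
            Literature.Analysis.FluidPDE.heatFlow (u s) (t - s) x -
              ∫ τ in Set.Ioo s t, ∫ y,
                Literature.Analysis.FluidPDE.oseenKernel (t - τ) (x - y) (u τ y) (u τ y)) ∧
          Literature.Analysis.FluidPDE.HasTypeITimeDecay C u) ∧
        ‖u (-1) 0‖ = C ∧
        (∀ (C' : ℝ) (u' : ℝ → E3 → E3),
          (ContDiffOn ℝ (⊤ : ℕ∞) (Function.uncurry u') (Set.Iio 0 ×ˢ Set.univ) ∧
            (∀ t < 0, Literature.Analysis.FluidPDE.VectorCalculus.IsDivFree (u' t)) ∧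
            (∀ s t : ℝ, s < t → t < 0 → ∀ x, u' t x =
              Literature.Analysis.FluidPDE.heatFlow (u' s) (t - s) x -
                ∫ τ in Set.Ioo s t, ∫ y,
                  Literature.Analysis.FluidPDE.oseenKernel (t - τ) (x - y) (u' τ y) (u' τ y)) ∧
            Literature.Analysis.FluidPDE.HasTypeITimeDecay C' u') →
          (∃ t < 0, ∃ x, u' t x ≠ 0) → C ≤ C') →
      (∃ c : ℝ, 0 < c ∧ c ≠ 1 ∧ ∃ (b : E3) (R : E3 ≃ₗᵢ[ℝ] E3),
        ∀ t < 0, ∀ x, c • u (c ^ 2 * t) (c • x) = R (u t (R.symm (x - b)))) →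
      ∃ δ₀ : ℝ, 0 < δ₀ ∧ ∀ c : ℝ, |c - 1| < δ₀ →
        ∃ (δ : ℝ) (b : E3) (R : E3 ≃ₗᵢ[ℝ] E3), 0 ≤ δ ∧
          ∀ t < 0, ∀ x, c • u (c ^ 2 * t) (c • x) = R (u (t - δ) (R.symm (x - b))) := by
  intro C u hC hext hper
  obtain ⟨hcls, hnorm, -⟩ := hext
  obtain ⟨c, hc, hc1, b, R, hper⟩ := hper
  obtain ⟨c', R', x₀, hc', hrdss⟩ := stub_periodToRDSS u c b R hc hc1 hper
  have h0 := stub_rdssLiouville C u c' R' x₀ hcls hc' hrdss (-1) (by norm_num) 0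
  rw [h0, norm_zero] at hnorm
  exact absurd hnorm hC.ne

/-- **stub 3a — `stub_closedSubgroupCharacter` (LANDED p147108, `Theorems/…StubClosedSubgroupCharacter.lean`; a THEOREM: von Neumann–Cartan for linear groups, in
tree as `Literature.Analysis.Calculus.exists_exp_chart_of_isClosed`, plus a countability argument).** Let `H` be a
subgroup of the units of a finite-dimensional real Banach algebra `𝔸`, closed in `𝔸`, and `ℓ : 𝔸 →L[ℝ] ℝ` a linear
functional multiplicative on `H` (a character) whose values on `H` cover a neighbourhood of `1`. Then some
one-parameter subgroup `t ↦ exp (t • X)` of `H` has unit character speed `ℓ X = 1`. Proof on paper: by the exponential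
chart every `u ∈ H` near `1` is `exp X` with `exp(ℝX) ⊆ H`; if `ℓ` vanished on all such `X` then
`t ↦ ℓ (exp (tX))`, a continuous multiplicative function with zero derivative, is `≡ 1`, so `ℓ ≡ 1` on `H` near
`1`, so `ℓ|_H` is locally constant (translate by `h⁻¹`), so `ℓ '' H` is countable (`H` is second countable) —
contradicting `Ioo (1-δ) (1+δ) ⊆ ℓ '' H`. -/
theorem stub_closedSubgroupCharacter :
    ∀ {𝔸 : Type} [NormedRing 𝔸] [NormedAlgebra ℚ 𝔸] [NormedAlgebra ℝ 𝔸] [CompleteSpace 𝔸]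
      [FiniteDimensional ℝ 𝔸] (H : Set 𝔸) (ℓ : 𝔸 →L[ℝ] ℝ),
      IsClosed H → (1 : 𝔸) ∈ H → (∀ a ∈ H, ∀ b ∈ H, a * b ∈ H) → (∀ a ∈ H, ∃ b ∈ H, b * a = 1) →
      (∀ a ∈ H, ∀ b ∈ H, ℓ (a * b) = ℓ a * ℓ b) →
      (∃ δ : ℝ, 0 < δ ∧ Set.Ioo (1 - δ) (1 + δ) ⊆ ℓ '' H) →
      ∃ X : 𝔸, ℓ X = 1 ∧ ∀ t : ℝ, NormedSpace.exp (t • X) ∈ H :=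
  fun H ℓ => _root_.Summit.NavierStokesRegularity.NavierStokesRegularity.Theorems.ExtremalSpiralSymmetry.Registered.stub_closedSubgroupCharacter H ℓ

/-- **stub 3b — `stub_generatorOfFamily` (LANDED p147157, `Theorems/…StubGeneratorOfFamily.lean`; chain rule).** If `u` is differentiable on the open slab `t < 0` and
`s ↦ (c s, R s, b s)` is a family of rigid parabolic scaling symmetries of `u`,
`c s • u ((c s)² t, c s • x) = R s (u t (Q s (x - b s)))` with `Q s` the inverse of `R s`, passing through the
identity at `s = 0` and differentiable there with `ċ(0) = 1`, `ḃ(0) = a`, `Ṙ(0) = A`, `Q̇(0) = -A`, then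
differentiating at `s = 0` gives the spiral-scaling generator `∇u·(a + x + Ax) + u + 2t ∂ₜu − Au = 0`. -/
theorem stub_generatorOfFamily :
    ∀ (u : ℝ → E3 → E3), DifferentiableOn ℝ (Function.uncurry u) (Set.Iio 0 ×ˢ Set.univ) →
      ∀ (c : ℝ → ℝ) (b : ℝ → E3) (R Q : ℝ → (E3 →L[ℝ] E3)) (a : E3) (A : E3 →L[ℝ] E3),
        c 0 = 1 → b 0 = 0 → R 0 = ContinuousLinearMap.id ℝ E3 → Q 0 = ContinuousLinearMap.id ℝ E3 →
        HasDerivAt c 1 0 → HasDerivAt b a 0 → HasDerivAt R A 0 → HasDerivAt Q (-A) 0 →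
        (∀ s : ℝ, ∀ t < 0, ∀ x, c s • u (c s ^ 2 * t) (c s • x) = R s (u t (Q s (x - b s)))) →
        ∀ t < 0, ∀ x, fderiv ℝ (u t) x (a + x + A x) + u t x +
          (2 * t) • Literature.Analysis.FluidPDE.timeDeriv u t x - A (u t x) = 0 :=
  _root_.Summit.NavierStokesRegularity.NavierStokesRegularity.Theorems.ExtremalSpiralSymmetry.Registered.stub_generatorOfFamily

/-- **stub 3c-i — `stub_stabiliserClosedSubgroup` (LANDED p149187, `Theorems/…StubStabiliserClosedSubgroup.lean`; lead).** For `u` continuous on the open slab, the image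
`Stab(u) ⊆ 𝕍` of its rigid parabolic scaling symmetries is CLOSED (limits of isometries are isometries; the coordinate
`c⁻¹` keeps `c` away from `0`; the symmetry identity passes to the limit by continuity), contains `1`, is closed under
products (`(c,R,b)(c',R',b') = (cc', RR', Rb' + b/c')`) and has left inverses (`(c,R,b)⁻¹ = (c⁻¹, R⁻¹, -cR⁻¹b)`). -/
theorem stub_stabiliserClosedSubgroup :
    ∀ (u : ℝ → E3 → E3), ContinuousOn (Function.uncurry u) (Set.Iio 0 ×ˢ Set.univ) →
      IsClosed Stab(u) ∧ (1 : 𝕍) ∈ Stab(u) ∧ (∀ M ∈ Stab(u), ∀ M' ∈ Stab(u), M * M' ∈ Stab(u)) ∧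
      (∀ M ∈ Stab(u), ∃ N ∈ Stab(u), N * M = 1) :=
  _root_.Summit.NavierStokesRegularity.NavierStokesRegularity.Theorems.ExtremalSpiralSymmetry.Registered.stub_stabiliserClosedSubgroup

/-- **stub 3c-ii — `stub_symmetryFamily` (LANDED p149196, `Theorems/…StubSymmetryFamily.lean`; lead).** Granted the closed-subgroup character lemma (stub 3a, quoted
as the first hypothesis) and the closed-group facts about `Stab(u)` (stub 3c-i, quoted as hypotheses), a field `u`
whose parabolic rescalings `S_c u` for all `c` near `1` are rigid motions of `u` on `t < 0` (NO regularity of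
`c ↦ (b, R)` assumed) carries a differentiable one-parameter family of rigid scaling symmetries through the identity
with unit dilation speed and skew rotation speed: the dilation `ℓ = pr₂ : 𝕍 → ℝ` is a character of `Stab(u)` covering
`(1-δ₀, 1+δ₀)`, stub 3a gives `exp(sX) ∈ Stab(u)` with `ℓ X = 1`, the components of `exp(sX)` are the family, and
skewness of `A = Ṙ(0)` follows from `‖R(s)x‖ = ‖x‖`. -/
theorem stub_symmetryFamily :
    (∀ {𝔸 : Type} [NormedRing 𝔸] [NormedAlgebra ℚ 𝔸] [NormedAlgebra ℝ 𝔸] [CompleteSpace 𝔸]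
      [FiniteDimensional ℝ 𝔸] (H : Set 𝔸) (ℓ : 𝔸 →L[ℝ] ℝ),
      IsClosed H → (1 : 𝔸) ∈ H → (∀ a ∈ H, ∀ b ∈ H, a * b ∈ H) → (∀ a ∈ H, ∃ b ∈ H, b * a = 1) →
      (∀ a ∈ H, ∀ b ∈ H, ℓ (a * b) = ℓ a * ℓ b) →
      (∃ δ : ℝ, 0 < δ ∧ Set.Ioo (1 - δ) (1 + δ) ⊆ ℓ '' H) →
      ∃ X : 𝔸, ℓ X = 1 ∧ ∀ t : ℝ, NormedSpace.exp (t • X) ∈ H) →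
    ∀ (u : ℝ → E3 → E3), IsClosed Stab(u) → (1 : 𝕍) ∈ Stab(u) →
      (∀ M ∈ Stab(u), ∀ M' ∈ Stab(u), M * M' ∈ Stab(u)) → (∀ M ∈ Stab(u), ∃ N ∈ Stab(u), N * M = 1) →
      (∃ δ₀ : ℝ, 0 < δ₀ ∧ ∀ c : ℝ, |c - 1| < δ₀ →
        ∃ (b : E3) (R : E3 ≃ₗᵢ[ℝ] E3),
          ∀ t < 0, ∀ x, c • u (c ^ 2 * t) (c • x) = R (u t (R.symm (x - b)))) →
      ∃ (c : ℝ → ℝ) (b : ℝ → E3) (R Q : ℝ → (E3 →L[ℝ] E3)) (a : E3) (A : E3 →L[ℝ] E3),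
        c 0 = 1 ∧ b 0 = 0 ∧ R 0 = ContinuousLinearMap.id ℝ E3 ∧ Q 0 = ContinuousLinearMap.id ℝ E3 ∧
        HasDerivAt c 1 0 ∧ HasDerivAt b a 0 ∧ HasDerivAt R A 0 ∧ HasDerivAt Q (-A) 0 ∧
        (∀ x, inner ℝ (A x) x = 0) ∧
        ∀ s : ℝ, ∀ t < 0, ∀ x, c s • u (c s ^ 2 * t) (c s • x) = R s (u t (Q s (x - b s))) :=
  _root_.Summit.NavierStokesRegularity.NavierStokesRegularity.Theorems.ExtremalSpiralSymmetry.Registered.stub_symmetryFamily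

/-- **The spiral generator from the local rigid stabiliser** (formerly the single stub `stub_spiralGenerator`,
now PROVED from stubs 3a, 3b, 3c-i, 3c-ii): a field differentiable on the open slab whose parabolic rescalings `S_c u`, for all
factors `c` near `1`, are rigid motions of `u` on `t < 0` has an infinitesimal spiral-scaling symmetry with skew
rotation part — exactly the generator of the crux. -/
theorem spiralGenerator_of_stubs :
    ∀ (u : ℝ → E3 → E3), DifferentiableOn ℝ (Function.uncurry u) (Set.Iio 0 ×ˢ Set.univ) →
      (∃ δ₀ : ℝ, 0 < δ₀ ∧ ∀ c : ℝ, |c - 1| < δ₀ →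
        ∃ (b : E3) (R : E3 ≃ₗᵢ[ℝ] E3),
          ∀ t < 0, ∀ x, c • u (c ^ 2 * t) (c • x) = R (u t (R.symm (x - b)))) →
      ∃ (a : E3) (A : E3 →L[ℝ] E3), (∀ x, inner ℝ (A x) x = 0) ∧
        ∀ t < 0, ∀ x, fderiv ℝ (u t) x (a + x + A x) + u t x +
          (2 * t) • Literature.Analysis.FluidPDE.timeDeriv u t x - A (u t x) = 0 := by
  intro u hdiff hloc
  obtain ⟨hcl, h1, hmul, hinv⟩ := stub_stabiliserClosedSubgroup u hdiff.continuousOn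
  obtain ⟨c, b, R, Q, a, A, hc0, hb0, hR0, hQ0, hc, hb, hR, hQ, hskew, hsym⟩ :=
    stub_symmetryFamily stub_closedSubgroupCharacter u hcl h1 hmul hinv hloc
  exact ⟨a, A, hskew, stub_generatorOfFamily u hdiff c b R Q a A hc0 hb0 hR0 hQ0 hc hb hR hQ hsym⟩

/-- **Pinning the time shift** (the crux text's "extremality pins the blow-up time of the symmetry to
`T′ = 0`"): if the Type-I bound of `u` with constant `C > 0` is attained at `(−1, 0)` and
`S_c u = g_{b,R} θ_δ u` on `t < 0` with `c > 0`, `δ ≥ 0`, then `δ = 0`. Evaluate at the transported hot spot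
`(−1/c², 0)`: the left side has norm `c·C`, the right side at most `C/√(1/c² + δ)`, whence `c²δ ≤ 0`. -/
theorem timeShift_pinned {C : ℝ} {u : ℝ → E3 → E3} (hC : 0 < C)
    (hI : Literature.Analysis.FluidPDE.HasTypeITimeDecay C u) (hnorm : ‖u (-1) 0‖ = C)
    {c δ : ℝ} (hc : 0 < c) (hδ : 0 ≤ δ) {b : E3} {R : E3 ≃ₗᵢ[ℝ] E3}
    (heq : ∀ t < 0, ∀ x, c • u (c ^ 2 * t) (c • x) = R (u (t - δ) (R.symm (x - b)))) : δ = 0 := by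
  have hc2 : 0 < c ^ 2 := by positivity
  have ht₀ : -(1 / c ^ 2) < 0 := neg_neg_of_pos (by positivity)
  have key := heq (-(1 / c ^ 2)) ht₀ 0
  have e1 : c ^ 2 * (-(1 / c ^ 2)) = -1 := by field_simp
  rw [e1, smul_zero] at key
  have hL : ‖c • u (-1) 0‖ = c * C := by
    rw [norm_smul, Real.norm_of_nonneg hc.le, hnorm]
  have hs : -(1 / c ^ 2) - δ < 0 := by linarith
  have hR : ‖R (u (-(1 / c ^ 2) - δ) (R.symm (0 - b)))‖ ≤ C / Real.sqrt (-(-(1 / c ^ 2) - δ)) := by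
    rw [LinearIsometryEquiv.norm_map]
    exact hI _ hs _
  rw [← key, hL] at hR
  have e2 : -(-(1 / c ^ 2) - δ) = 1 / c ^ 2 + δ := by ring
  rw [e2] at hR
  have hpos : 0 < 1 / c ^ 2 + δ := by positivity
  have hsq : 0 < Real.sqrt (1 / c ^ 2 + δ) := Real.sqrt_pos.2 hpos
  -- `c C ≤ C / √(1/c² + δ)`, so `c √(1/c² + δ) ≤ 1`
  have h3 : c * Real.sqrt (1 / c ^ 2 + δ) ≤ 1 := by
    rw [le_div_iff₀ hsq] at hR
    by_contra h
    push Not at h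
    have : C * 1 < C * (c * Real.sqrt (1 / c ^ 2 + δ)) := mul_lt_mul_of_pos_left h hC
    nlinarith
  -- square it: `c² (1/c² + δ) ≤ 1`, i.e. `c² δ ≤ 0`
  have h4 : c ^ 2 * (1 / c ^ 2 + δ) ≤ 1 := by
    have h3' : 0 ≤ c * Real.sqrt (1 / c ^ 2 + δ) := by positivity
    calc c ^ 2 * (1 / c ^ 2 + δ) = (c * Real.sqrt (1 / c ^ 2 + δ)) ^ 2 := by
          rw [mul_pow, Real.sq_sqrt hpos.le]
      _ ≤ 1 := pow_le_one₀ h3' h3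
  have e3 : c ^ 2 * (1 / c ^ 2 + δ) = 1 + c ^ 2 * δ := by
    field_simp
  rw [e3] at h4
  have h5 : c ^ 2 * δ ≤ 0 := by linarith
  have h6 : δ ≤ 0 := by
    by_contra h
    push Not at h
    have : 0 < c ^ 2 * δ := mul_pos hc2 h
    linarith
  exact le_antisymm h6 hδ

/-- **Birth composition (the skeleton theorem).** The crux BY NAME from the registered stubs (stub 1 by name,
stubs 2a–2b through `continuousOfDiscrete_of_stubs`, stubs 3a–3c through `spiralGenerator_of_stubs`), used by name: recurrence ↦ pinning `δ = 0` ↦ rigidity ↦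
pinning for every factor in `|c − 1| < min δ₀ ½` ↦ local rigid stabiliser ↦ generator (differentiability extracted from the class). Closed twin with the stub statements as
hypotheses: `bc/ExtremalSpiralSymmetry_birth_closed.lean` (registrar evidence). -/
theorem ExtremalSpiralSymmetry_of : Theses.ExtremalTypeIConstant.ExtremalSpiralSymmetry := by
  have hrec := stub_scalingRecurrence
  have hrig := continuousOfDiscrete_of_stubs
  have hgen := spiralGenerator_of_stubs
  intro C u hC hext
  obtain ⟨hcls, hnorm, hmin⟩ := hext
  have hI : Literature.Analysis.FluidPDE.HasTypeITimeDecay C u := hcls.2.2.2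
  -- stub 1: one scaling period modulo rigid motions and a forward time shift
  obtain ⟨c, hc, hc1, δ, b, R, hδ, heq⟩ := hrec C u hC ⟨hcls, hnorm, hmin⟩
  -- pinning: the time shift vanishes
  have hδ0 : δ = 0 := timeShift_pinned hC hI hnorm hc hδ heq
  subst hδ0
  have heq' : ∀ t < 0, ∀ x, c • u (c ^ 2 * t) (c • x) = R (u t (R.symm (x - b))) := by
    intro t ht x
    simpa only [sub_zero] using heq t ht x
  -- stub 2: symmetries for every factor near 1, each pinned to a rigid motion
  obtain ⟨δ₀, hδ₀, hfam⟩ := hrig C u hC ⟨hcls, hnorm, hmin⟩ ⟨c, hc, hc1, b, R, heq'⟩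
  have hloc : ∃ δ₁ : ℝ, 0 < δ₁ ∧ ∀ c' : ℝ, |c' - 1| < δ₁ →
      ∃ (b' : E3) (R' : E3 ≃ₗᵢ[ℝ] E3),
        ∀ t < 0, ∀ x, c' • u (c' ^ 2 * t) (c' • x) = R' (u t (R'.symm (x - b'))) := by
    refine ⟨min δ₀ (1 / 2), lt_min hδ₀ (by norm_num), fun c' hc' => ?_⟩
    have h1 : |c' - 1| < δ₀ := lt_of_lt_of_le hc' (min_le_left _ _)
    have h2 : |c' - 1| < 1 / 2 := lt_of_lt_of_le hc' (min_le_right _ _)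
    have hc'pos : 0 < c' := by
      have := (abs_lt.1 h2).1
      linarith
    obtain ⟨δ', b', R', hδ', heq''⟩ := hfam c' h1
    have hδ'0 : δ' = 0 := timeShift_pinned hC hI hnorm hc'pos hδ' heq''
    subst hδ'0
    exact ⟨b', R', fun t ht x => by simpa only [sub_zero] using heq'' t ht x⟩
  -- stub 3: the local rigid stabiliser yields the infinitesimal spiral-scaling generator
  have hdiff : DifferentiableOn ℝ (Function.uncurry u) (Set.Iio 0 ×ˢ Set.univ) :=
    hcls.1.differentiableOn (by simp)
  exact hgen u hdiff hloc

end Summit.NavierStokesRegularity.NavierStokesRegularity.Cruxes.ExtremalSpiralSymmetry.Birth
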